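import Literature.NumberTheory.EllipticCurves.X049TwistMinimalModelProofs
import Literature.NumberTheory.EllipticCurves.Cm7QuadraticTwistGoodAtTwo
import Literature.NumberTheory.EllipticCurves.JInvariantNeg3375BadReductionAboveSevenProofs
import Literature.NumberTheory.EllipticCurves.QuadraticTwistKroneckerLFunctionProofs
import Literature.NumberTheory.EllipticCurves.QuadraticTwistKroneckerEvenRootNumberProofs
import Literature.NumberTheory.EllipticCurves.QuadraticTwistJInvariantProofs
import Literature.NumberTheory.EllipticCurves.ModularityVersionApProofs
import Literature.NumberTheory.EllipticCurves.LFunctionPrimeCoeff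
import Literature.NumberTheory.EllipticCurves.LFunctionSmulProofs
import Literature.NumberTheory.EllipticCurves.BertrandCMHeightNonvanishingTwo
import Literature.NumberTheory.EllipticCurves.X049CanonicalPAdicHeightSqTwoProofs
import Literature.NumberTheory.DiophantineGeometry.LocalReductionProofs
import HarnessLib

/-!
# Road (C) `disegni-pair-two` on crux stmt-BirchSwinnertonDyer-20368 — FRAME, the good partner `V = 49a1^{(d′)}`

LEAD `bsd-line-cf2-p1` g21, for the registered stub `stub_frame_two` of `Lines/disegni_pair_two.lean` (v3). For a member
`W` of a road-(C) class (`C₀ • W = 49a1^{(d* d′)}`, `d′ ≡ 1 (mod 4)` squarefree, `d* ∈ {2, −1, −2}`):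
* §1 the GOOD PARTNER `V = W_k = [1, −(3k+1), 0, −2d′², −d′³]` (`d′ = 4k+1`), globally minimal, `C₁ • V = 49a1^{(d′)}`, and
  the member's explicit model `C • W = V^{(d*)}` (`exists_goodPartner_model`);
* §2 reduction: `V` is good at `2` (odd conductor) and good at every odd prime where `W` is good
  (`hasGoodReductionAt_partner_of_member`: the bad primes of `W` contain `7` — `j = −3375` — and the primes of `d′`);
* §3 Dirichlet coefficients `aₘ(W) = χ_{d*}(m) aₘ(V)` with `χ_{d*}(m) = (d*/m)` for odd `m`, `0` for even `m`
  (`LFunction_member_eq`), and the companion twist `W^{(e)} ≅ (V^{(d*)})^{(e)}`.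
THEOREMS ONLY; no `sorry`; no new definitions. BSD is not proved by any of this; 20368 is not closed here.
-/

set_option linter.dupNamespace false

noncomputable section

open scoped Classical NumberField NumberTheorySymbols

open NumberField IsDedekindDomain WeierstrassCurve Literature.NumberTheory.EllipticCurves
  Literature.NumberTheory.EllipticCurves.JNeg3375

namespace Summit.BirchSwinnertonDyer.BirchSwinnertonDyer.Theorems.PrintCf2.DisegniPairTwo

/-! ### §1 The good partner and the member's explicit model -/

/-- **The good partner `V = W_k` of a road-(C) member and the member's model `C • W = V^{(d*)}`.** For
`C₀ • W = 49a1^{(d* d′)}` with `d′ = 4k + 1` squarefree: the integral model `W_k` is elliptic and globally minimal,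
`C₁ • W_k = 49a1^{(d′)}`, and `C • W = W_k^{(d*)}` (twisting commutes with isomorphisms: `quadraticTwist_smul`;
`(E^{(a)})^{(b)} = E^{(ab)}`). [cite: SilvermanAEC2009, X.2 Prop. 2.4 and X.5 Cor. 5.4.1] -/
theorem exists_goodPartner_model {ds d' : ℤ} (hd4 : d' % 4 = 1) (hsq : Squarefree d')
    (W : WeierstrassCurve ℚ) (C₀ : VariableChange ℚ) (hC₀ : C₀ • W = cm7.quadraticTwist (((ds * d' : ℤ)) : ℚ)) :
    ∃ (k : ℤ) (V : WeierstrassCurve ℚ), d' = 4 * k + 1 ∧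
      V = ⟨1, -(3 * (k : ℚ) + 1), 0, -2 * (4 * (k : ℚ) + 1) ^ 2, -(4 * (k : ℚ) + 1) ^ 3⟩ ∧
      V.IsElliptic ∧ V.IsGloballyMinimal ∧
      (∃ C₁ : VariableChange ℚ, C₁ • V = cm7.quadraticTwist (d' : ℚ)) ∧
      ∃ C : VariableChange ℚ, C • W = V.quadraticTwist (ds : ℚ) := by
  obtain ⟨k, rfl⟩ : ∃ k : ℤ, d' = 4 * k + 1 := ⟨d' / 4, by omega⟩
  set V : WeierstrassCurve ℚ := ⟨1, -(3 * (k : ℚ) + 1), 0, -2 * (4 * (k : ℚ) + 1) ^ 2, -(4 * (k : ℚ) + 1) ^ 3⟩ with hV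
  set A : VariableChange ℚ := ⟨1, 0, 1 / 2, 0⟩ with hA
  have hAV : A • cm7.quadraticTwist (((4 * k + 1 : ℤ)) : ℚ) = V := by
    rw [hA, cm7_quadraticTwist_smul_eq k]
    ext <;> simp [WeierstrassCurve.map, hV]
  have hC₁ : A⁻¹ • V = cm7.quadraticTwist (((4 * k + 1 : ℤ)) : ℚ) := by rw [← hAV, inv_smul_smul]
  set B : VariableChange ℚ := (⟨A⁻¹.u, (ds : ℚ) * A⁻¹.r, 0, 0⟩ : VariableChange ℚ) with hB
  have hW : C₀ • W = B • V.quadraticTwist (ds : ℚ) := by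
    rw [hC₀, show (((ds * (4 * k + 1) : ℤ)) : ℚ) = (((4 * k + 1 : ℤ)) : ℚ) * (ds : ℚ) by push_cast; ring,
      ← quadraticTwist_quadraticTwist, ← hC₁, quadraticTwist_smul]
  refine ⟨k, V, rfl, hV, cm7Twist_isElliptic V k hV, cm7Twist_isGloballyMinimal_of_squarefree V k hV hsq, ⟨A⁻¹, hC₁⟩,
    B⁻¹ * C₀, ?_⟩
  rw [mul_smul, hW, inv_smul_smul]

/-- The companion twist: `C • W = X` ⟹ `⟨u, e r, 0, 0⟩ • W^{(e)} = X^{(e)}` (twisting commutes with isomorphisms).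
[cite: SilvermanAEC2009, X.2 Prop. 2.4] -/
theorem exists_smul_quadraticTwist_of_smul_eq {W X : WeierstrassCurve ℚ} {C : VariableChange ℚ} (hC : C • W = X)
    (e : ℚ) : ∃ C' : VariableChange ℚ, C' • W.quadraticTwist e = X.quadraticTwist e :=
  ⟨⟨C.u, e * C.r, 0, 0⟩, by rw [← hC, quadraticTwist_smul]⟩

/-! ### §2 Reduction of the partner -/

variable (V : WeierstrassCurve ℚ) (k : ℤ)

/-- `49a1 = W_0`. [cite: SilvermanATAEC1994, App. A §3 (row D = −7)] -/
theorem cm7_eq_cm7Twist_zero :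
    cm7 = ⟨1, -(3 * ((0 : ℤ) : ℚ) + 1), 0, -2 * (4 * ((0 : ℤ) : ℚ) + 1) ^ 2, -(4 * ((0 : ℤ) : ℚ) + 1) ^ 3⟩ := by
  ext <;> norm_num

/-- `49a1` has good reduction at every prime `ℓ ≠ 7`. [cite: SilvermanATAEC1994, App. A §3 (conductor 7²)] -/
theorem hasGoodReductionAtPrime_cm7_of_ne_seven (ℓ : ℕ) [Fact ℓ.Prime] (h7 : ℓ ≠ 7) : cm7.HasGoodReductionAtPrime ℓ :=
  haveI := cm7_isGloballyMinimal
  cm7Twist_hasGoodReductionAtPrime cm7 0 cm7_eq_cm7Twist_zero ℓ h7 (by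
    intro h; have := Int.le_of_dvd (by norm_num) h; have h2 := (Fact.out : ℓ.Prime).two_le; omega)

/-- The rational prime under a finite place of `ℚ` lies in it. [folklore] -/
theorem natCast_primesEquiv_mem_asIdeal (v : HeightOneSpectrum (𝓞 ℚ)) :
    ((Rat.HeightOneSpectrum.primesEquiv v : ℕ) : 𝓞 ℚ) ∈ v.asIdeal := by
  have h := (Rat.HeightOneSpectrum.natGenerator_dvd_iff v).mp dvd_rfl
  rwa [← map_natCast (Rat.IsIntegralClosure.intEquiv (𝓞 ℚ)), Ideal.apply_mem_of_equiv_iff] at h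

/-- **`W_k` has odd conductor** (good reduction at `2`). [cite: SilvermanAEC2009, VII.1 Remark 1.1] -/
theorem not_two_dvd_conductorNorm_partner [V.IsElliptic] [V.IsGloballyMinimal]
    (hV : V = ⟨1, -(3 * (k : ℚ) + 1), 0, -2 * (4 * (k : ℚ) + 1) ^ 2, -(4 * (k : ℚ) + 1) ^ 3⟩) :
    ¬ 2 ∣ V.conductorNorm ℤ := by
  haveI : Fact (2 : ℕ).Prime := ⟨Nat.prime_two⟩
  rw [V.dvd_conductorNorm_iff_not_hasGoodReductionAtPrime 2, not_not]
  exact cm7Twist_hasGoodReductionAtPrime_two V k hV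

/-- **Every model of `49a1^{(m)}` has `j = −3375`, hence BAD reduction at `7`** (`ord₇ Δ` odd).
[cite: SilvermanAEC2009, VII.5 Prop. 5.1 (a)] [cite: SilvermanATAEC1994, App. A §3] -/
theorem not_hasGoodReductionAt_seven_of_j (W : WeierstrassCurve ℚ) [W.IsElliptic] (hj : W.j = -3375)
    (v : HeightOneSpectrum (𝓞 ℚ)) (hv : (Rat.HeightOneSpectrum.primesEquiv v : ℕ) = 7) : ¬ W.HasGoodReductionAt v := by
  have h7 : (7 : 𝓞 ℚ) ∈ v.asIdeal := by
    have := natCast_primesEquiv_mem_asIdeal v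
    rw [hv] at this
    exact_mod_cast this
  have h := not_hasGoodReductionAt_baseChange_of_j_eq_neg3375 W hj ℚ (by rw [Module.finrank_self]; norm_num) v h7
  have key : ∀ f : ℚ →+* ℚ, W.map f = W := fun f => by
    rw [Subsingleton.elim f (RingHom.id ℚ), WeierstrassCurve.map_id]
  unfold WeierstrassCurve.baseChange at h
  rwa [key] at h

/-- **The partner is good wherever the member is good (odd primes).** With `V = W_k` globally minimal, `d′ = 4k+1`
squarefree, `C₁ • V = 49a1^{(d′)}`, `C • W = V^{(d*)}`, `d* ∈ {2, −1, −2}`: if `W` has good reduction at an odd place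
`v` then so has `V`. (Contrapositive: `V` is bad only at `7` and at the primes of `d′`; there `W ≅ 49a1^{(d* d′)}` is bad —
`j = −3375` at `7`, additive `I₀*`-type twist at `ℓ ∥ d* d′`.) [cite: SilvermanAEC2009, VII.5 Prop. 5.1 and X.2] -/
theorem hasGoodReductionAt_partner_of_member [V.IsElliptic] [V.IsGloballyMinimal]
    (hV : V = ⟨1, -(3 * (k : ℚ) + 1), 0, -2 * (4 * (k : ℚ) + 1) ^ 2, -(4 * (k : ℚ) + 1) ^ 3⟩)
    (hsq : Squarefree (4 * k + 1)) {C₁ : VariableChange ℚ} (hC₁ : C₁ • V = cm7.quadraticTwist (((4 * k + 1 : ℤ)) : ℚ))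
    {ds : ℤ} (hds : ds = 2 ∨ ds = -1 ∨ ds = -2) {W : WeierstrassCurve ℚ} [W.IsElliptic] {C : VariableChange ℚ}
    (hC : C • W = V.quadraticTwist (ds : ℚ)) (v : HeightOneSpectrum (𝓞 ℚ))
    (hv2 : (Rat.HeightOneSpectrum.primesEquiv v : ℕ) ≠ 2) (hW : W.HasGoodReductionAt v) : V.HasGoodReductionAt v := by
  set ℓ : ℕ := (Rat.HeightOneSpectrum.primesEquiv v : ℕ) with hℓ
  haveI hℓp : Fact ℓ.Prime := ⟨(Rat.HeightOneSpectrum.primesEquiv v).2⟩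
  have hds0 : ds ≠ 0 := by rcases hds with rfl | rfl | rfl <;> decide
  have hdsQ : (ds : ℚ) ≠ 0 := Int.cast_ne_zero.mpr hds0
  haveI : (V.quadraticTwist (ds : ℚ)).IsElliptic := V.isElliptic_quadraticTwist hdsQ
  by_contra hbad
  -- `V` is bad only above `7` and the primes of `d′`
  have hcases : ℓ = 7 ∨ (ℓ : ℤ) ∣ 4 * k + 1 := by
    by_contra h
    obtain ⟨h1, h2⟩ := not_or.mp h
    exact hbad ((hasGoodReductionAtPrime_primesEquiv_iff_holds V v ℓ rfl).mp
      (cm7Twist_hasGoodReductionAtPrime V k hV ℓ h1 h2))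
  -- `j(W) = −3375`
  have hjC : ∀ (X : WeierstrassCurve ℚ) [X.IsElliptic], C • W = X → (C • W).j = X.j := by
    intro X _ h
    subst h
    rfl
  have hjW : W.j = -3375 := by
    rw [← variableChange_j W C, hjC _ hC, j_quadraticTwist V hdsQ, cm7Twist_j V k hV]
  rcases hcases with h7 | hdvd
  · exact not_hasGoodReductionAt_seven_of_j W hjW v h7 hW
  · by_cases h7 : ℓ = 7
    · exact not_hasGoodReductionAt_seven_of_j W hjW v h7 hW
    -- additive twist at `ℓ ∥ d* d′`
    haveI := cm7_isGloballyMinimal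
    have hgood7 : cm7.HasGoodReductionAt v :=
      (hasGoodReductionAtPrime_primesEquiv_iff_holds cm7 v ℓ rfl).mp (hasGoodReductionAtPrime_cm7_of_ne_seven ℓ h7)
    have hℓds : ¬ (ℓ : ℤ) ∣ ds := by
      intro h
      have h2 := hℓp.out.two_le
      have hn : ℓ ∣ ds.natAbs := Int.natCast_dvd.mp h
      have hle : ℓ ≤ ds.natAbs := Nat.le_of_dvd (Int.natAbs_pos.mpr hds0) hn
      have hds2 : ds.natAbs ≤ 2 := by rcases hds with rfl | rfl | rfl <;> decide
      have hℓ2 : ℓ ≠ 2 := hv2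
      omega
    have hD0 : ds * (4 * k + 1) ≠ 0 := mul_ne_zero hds0 (by omega)
    have h1 : ((ℓ : ℕ) : ℤ) ∣ ds * (4 * k + 1) := dvd_mul_of_dvd_right hdvd ds
    have h2 : ¬ ((ℓ : ℕ) : ℤ) ^ 2 ∣ ds * (4 * k + 1) := by
      intro h
      have hprime : Prime (ℓ : ℤ) := Nat.prime_iff_prime_int.mp hℓp.out
      have hcop : IsCoprime ((ℓ : ℤ) ^ 2) ds := IsCoprime.pow_left ((Prime.coprime_iff_not_dvd hprime).mpr hℓds)
      have hd' : (ℓ : ℤ) ^ 2 ∣ 4 * k + 1 := hcop.dvd_of_dvd_mul_left h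
      have hu := hsq (ℓ : ℤ) (by rw [← sq]; exact hd')
      rw [Int.isUnit_iff] at hu
      have h2' := hℓp.out.two_le
      omega
    have hadd := hasAdditiveReductionAt_quadraticTwist_of_dvd cm7 v hv2 hD0 h1 h2 hgood7
    -- transport to `W`: `49a1^{(d* d′)} = (C₁ • V)^{(d*)} = B • C • W`
    have hmodel : cm7.quadraticTwist (((ds * (4 * k + 1) : ℤ)) : ℚ) =
        ((⟨C₁.u, (ds : ℚ) * C₁.r, 0, 0⟩ : VariableChange ℚ) * C) • W := by
      rw [show (((ds * (4 * k + 1) : ℤ)) : ℚ) = (((4 * k + 1 : ℤ)) : ℚ) * (ds : ℚ) by push_cast; ring,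
        ← quadraticTwist_quadraticTwist, ← hC₁, quadraticTwist_smul, mul_smul, hC]
    rw [hmodel] at hadd
    exact ((hasAdditiveReductionAt_smul_iff_holds v W _).mp hadd).not_hasGoodReductionAt hW

/-! ### §3 Dirichlet coefficients of the member and of odd twists of the partner -/

/-- **`aₘ(W) = χ_{d*}(m)·aₘ(V)`** for the member `C • W = V^{(d*)}`, `d* ∈ {2, −1, −2}`, `V = W_k`: `χ_{d*}(m) = (d*/m)`
(Jacobi) for odd `m` and `0` for even `m` (`V^{(d*)} ≅ V^{(4d*)}`, an even fundamental discriminant prime to the odd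
conductor of `V`). [cite: SilvermanAEC2009, X.2 and Exercise 10.16] -/
theorem LFunction_member_eq [V.IsElliptic] [V.IsGloballyMinimal]
    (hV : V = ⟨1, -(3 * (k : ℚ) + 1), 0, -2 * (4 * (k : ℚ) + 1) ^ 2, -(4 * (k : ℚ) + 1) ^ 3⟩)
    {ds : ℤ} (hds : ds = 2 ∨ ds = -1 ∨ ds = -2) {W : WeierstrassCurve ℚ} [W.IsElliptic] {C : VariableChange ℚ}
    (hC : C • W = V.quadraticTwist (ds : ℚ)) (m : ℕ) :
    W.LFunction m = (if Even m then 0 else J(ds | m)) * V.LFunction m := by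
  have hds0 : ds ≠ 0 := by rcases hds with rfl | rfl | rfl <;> decide
  have hdsQ : (ds : ℚ) ≠ 0 := Int.cast_ne_zero.mpr hds0
  haveI : (V.quadraticTwist (ds : ℚ)).IsElliptic := V.isElliptic_quadraticTwist hdsQ
  -- `W ≅ V^{(d*)} ≅ V^{(4 d*)}`
  obtain ⟨C', hC'⟩ := V.exists_variableChange_quadraticTwist_mul_sq (ds : ℚ) 2 two_ne_zero
  have h1 : W.LFunction = (V.quadraticTwist (ds : ℚ)).LFunction := by rw [← hC, LFunction_smul]
  have h2 : (V.quadraticTwist (ds : ℚ)).LFunction = (V.quadraticTwist (((4 * ds : ℤ)) : ℚ)).LFunction := by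
    rw [← LFunction_smul _ C', hC', show (ds : ℚ) * 2 ^ 2 = (((4 * ds : ℤ)) : ℚ) by push_cast; ring]
  rw [h1, h2]
  have h4 : (4 : ℤ) ∣ 4 * ds := dvd_mul_right 4 ds
  have hq : 4 * ds / 4 = ds := by omega
  have hm4 : 4 * ds / 4 % 4 = 2 ∨ 4 * ds / 4 % 4 = 3 := by rw [hq]; rcases hds with rfl | rfl | rfl <;> decide
  have hsqd : Squarefree (4 * ds / 4) := by
    rw [hq]
    rcases hds with rfl | rfl | rfl
    · exact Int.prime_two.squarefree
    · exact isUnit_one.neg.squarefree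
    · rw [← Int.squarefree_natAbs, show (-2 : ℤ).natAbs = 2 by norm_num]
      exact Nat.prime_two.prime.squarefree
  have hN2 := not_two_dvd_conductorNorm_partner V k hV
  have hgcd : Int.gcd (4 * ds) (V.conductorNorm ℤ : ℤ) = 1 := by
    have hodd : Nat.Coprime 2 (V.conductorNorm ℤ) := (Nat.Prime.coprime_iff_not_dvd Nat.prime_two).mpr hN2
    have h8 : Nat.Coprime 8 (V.conductorNorm ℤ) := by
      have := Nat.Coprime.pow_left 3 hodd; simpa using this
    have h4' : Nat.Coprime 4 (V.conductorNorm ℤ) := by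
      have := Nat.Coprime.pow_left 2 hodd; simpa using this
    rw [Int.gcd_eq_natAbs]
    rcases hds with rfl | rfl | rfl <;> simpa using by first | exact h8 | exact h4'
  rw [V.LFunction_quadraticTwist_apply_of_four_dvd h4 hm4 hsqd hgcd m, hq]

/-- **The odd twist `V′ ≅ V^{(D)}` of the partner** (`D ≡ 1 (mod 4)` squarefree, `V` good at the primes of `D`): for any
model `C′ • V′ = V^{(D)}`, `aₙ(V′) = (n/|D|)·aₙ(V)` for all `n`. [cite: SilvermanAEC2009, X.2 and Exercise 10.16] -/
theorem LFunction_partnerTwist_eq [V.IsElliptic] {D : ℤ} (hD4 : D % 4 = 1) (hsq : Squarefree D)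
    (hgood : ∀ v : HeightOneSpectrum (𝓞 ℚ), ((Rat.HeightOneSpectrum.primesEquiv v : ℕ) : ℤ) ∣ D → V.HasGoodReductionAt v)
    {V' : WeierstrassCurve ℚ} [V'.IsElliptic] {C' : VariableChange ℚ} (hC' : C' • V' = V.quadraticTwist (D : ℚ)) (n : ℕ) :
    V'.LFunction n = J((n : ℤ) | D.natAbs) * V.LFunction n := by
  have h1 : V'.LFunction = (V.quadraticTwist (D : ℚ)).LFunction := by rw [← hC', LFunction_smul]
  rw [h1]
  exact V.LFunction_quadraticTwist_apply_of_emod_four_eq_one hD4 hsq hgood n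

/-- **`a₂(V′) = a₂(V)`** for the odd twist `V′ ≅ V^{(D)}` when `D ≡ 1 (mod 8)` (`(2/|D|) = 1`), both curves globally
minimal with good reduction at `2`. [cite: SilvermanAEC2009, X.2 and Exercise 10.16] -/
theorem frobeniusTrace_two_partnerTwist_eq [Fact (2 : ℕ).Prime] [V.IsElliptic] [V.IsGloballyMinimal] {D : ℤ}
    (hD8 : D % 8 = 1) (hsq : Squarefree D)
    (hgood : ∀ v : HeightOneSpectrum (𝓞 ℚ), ((Rat.HeightOneSpectrum.primesEquiv v : ℕ) : ℤ) ∣ D → V.HasGoodReductionAt v)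
    (hV2 : V.HasGoodReductionAtPrime 2)
    {V' : WeierstrassCurve ℚ} [V'.IsElliptic] [V'.IsGloballyMinimal] {C' : VariableChange ℚ}
    (hC' : C' • V' = V.quadraticTwist (D : ℚ)) (hV'2 : V'.HasGoodReductionAtPrime 2) :
    V'.frobeniusTrace 2 = V.frobeniusTrace 2 := by
  have h := LFunction_partnerTwist_eq V (by omega) hsq hgood hC' 2
  rw [LFunction_apply_prime_eq_frobeniusTrace V' 2 hV'2, LFunction_apply_prime_eq_frobeniusTrace V 2 hV2] at h
  have hJ : J(((2 : ℕ) : ℤ) | D.natAbs) = 1 :=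
    (Literature.NumberTheory.QuadraticFields.jacobiSym_two_natAbs_eq_one_iff (by omega)).mpr hD8
  rw [hJ, one_mul] at h
  exact_mod_cast h

end Summit.BirchSwinnertonDyer.BirchSwinnertonDyer.Theorems.PrintCf2.DisegniPairTwo

end
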